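import Summits.HodgeConjecture.HodgeConjecture.Theorems.NoetherLefschetzOneUpLevelZeroNetsSlice
import Summits.HodgeConjecture.HodgeConjecture.Theorems.AmpleAdicLefschetzAlgebraicClassesHodgeTypeProof

/-!
# Route NoetherLefschetzOneUp — `LevelZeroNets` (stmt-HodgeConjecture-11602), V:
# the item from the `V`-part ALONE

File IV (`NoetherLefschetzOneUpLevelZeroNetsSlice`) derived `LevelZeroNets` from two inputs: the
`V`-part `Arapura2022_thm_1_2_smoothPart_pgZeroSurfaceFibration` (Arapura 2022, Thm. 1.2 as
applied in the proof of Cor. 1.5: every rational `(2,2)`-class of the total space of a `p_g = 0`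
surface fibration with connected fibres over a smooth projective surface agrees, off some vertical
divisor `f⁻¹T`, with an algebraic class — named fact, no carrier: Leray filtration, decomposition
theorem, relative Hilbert schemes) and the `(2p,p)`-slice "algebraic classes are of Hodge type
`(p,p)` in every Hodge model". The slice is now a THEOREM of the tree, unconditionally:
`algebraicClasses_pullback_mem_hodgePQ` (`AmpleAdicLefschetzAlgebraicClassesHodgeType{Cyclic,
Bump,Resolution,Cech,Proof}`, item stmt-HodgeConjecture-15189 of route `AmpleAdicLefschetz`:
purity of the coniveau pieces, Hironaka, GAGA straightening, a Pontryagin–Thom bump class,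
Čech–Alexander duality, and the bidegree `(p,p)` of the Gysin morphism of a resolution). Feeding it
in gives

* `levelZeroNets_of_vPart` — **`LevelZeroNets` from the `V`-part alone.**

So the item rests on exactly ONE named fact. When
`Arapura2022_thm_1_2_smoothPart_pgZeroSurfaceFibration_holds` lands, the item closes by
`theorem levelZeroNets_proof : LevelZeroNets := levelZeroNets_of_vPart ‹_holds›`. Compared with
file III (`levelZeroNets_of_split_children`: seven named facts; `levelZeroNets_of_deligne_smoothPart`:
Deligne's Cor. 8.2.8 + the `V`-part), Lefschetz `(1,1)`, hard Lefschetz, the Hodge conjecture in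
dimension `≤ 3`, Voisin's Cor. 2.12 and Deligne's Cor. 8.2.8 have all left the trust base of this
item (the first four serve the sibling `VerticalHodgeAlgebraic`; the last is replaced by the proved
slice). Everything here is proved; no definitions, no named facts.
-/

set_option linter.dupNamespace false

noncomputable section

namespace Summit.HodgeConjecture.HodgeConjecture.Theorems

open Literature.AlgebraicGeometry.Motives Literature.AlgebraicGeometry.HodgeTheory
open Summit.HodgeConjecture.HodgeConjecture.Theses.NoetherLefschetzOneUp

/-- **`LevelZeroNets` from the `V`-part alone.** For every smooth projective complex fourfold `X`
and surjective `f : X ⟶ ℙ²` whose fibres over the complex points off a proper Zariski-closed `T`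
are smooth projective surfaces with `h^{2,0} = 0`, the span of the rational `(2,2)`-classes of `X`
lies in `algebraicClasses X 2 ⊔ span {rational (2,2)-classes dying off f⁻¹T' for some proper closed
T' ⊊ ℙ²}` — GRANTED only Arapura 2022, Thm. 1.2 as applied in the proof of Cor. 1.5
(`Arapura2022_thm_1_2_smoothPart_pgZeroSurfaceFibration`). Proof:
`levelZeroNets_of_algebraicClassesHodgeType_smoothPart` (file IV: connectedness of all fibres by
Zariski/Stein, rational descent, Hodge type of the vertical remainder) fed with the tree's theorem
`algebraicClasses_pullback_mem_hodgePQ` (algebraic classes are `(p,p)` in every Hodge model,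
unconditional). CONDITIONAL on the one named fact `hVpart`.
[cite: Arapura2022, Thm. 1.2 and proof of Cor. 1.5 (p. 5)] [cite: Deligne2000, §1] -/
theorem levelZeroNets_of_vPart
    (hVpart : Arapura2022_thm_1_2_smoothPart_pgZeroSurfaceFibration) : LevelZeroNets :=
  levelZeroNets_of_algebraicClassesHodgeType_smoothPart
    (fun _ _ hX A p _ hc ↦ algebraicClasses_pullback_mem_hodgePQ hX A p hc) hVpart

end Summit.HodgeConjecture.HodgeConjecture.Theorems

end
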